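import Summits.Ventures.PercRepro.C025ProfileStagedLine3Two

/-!
# SESSION 4 (continued) — LEMMA 3 ASSEMBLED: `rigid (Q ∪ {a, x}) ≤ 4` (night-3 g12; proofs/NIGHT3-G12-LINE3.md §2)
-/
open scoped Matroid
namespace PercRepro
open Set Finset ThmH
namespace Staged
variable {α : Type} [DecidableEq α] {M : Matroid α} [M.Finite]

/-- An `Ls`-term with zero excess is `≤ 0`. -/
theorem ls_term_nonpos_of_jB_eq_zero {B : Finset α} (x : α) (h : jB M B = 0) :
    ovf M B x / ((inner M B).card : ℚ) ≤ 0 := by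
  have hj : jsh M B = 0 := by unfold jsh; rw [h]; simp
  have hovf : ovf M B x ≤ 0 := by unfold ovf; rw [hj]; linarith [take_nonneg (M := M) B x]
  exact div_nonpos_of_nonpos_of_nonneg hovf (by positivity)

/-- The two triples `Q ∪ a`, `Q ∪ x` of `S = Q ∪ {a, x}` (rank `4`, `Q` of rank `2`) have rank `3`. -/
theorem rkN_triples_eq_three {Q : Finset α} {a x : α} (hQ2 : rkN M Q = 2)
    (hS4 : rkN M (insert a (insert x Q)) = 4) : rkN M (insert a Q) = 3 ∧ rkN M (insert x Q) = 3 := by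
  have h1 := rkN_insert_le (M := M) (X := Q) a
  have h2 := rkN_insert_le (M := M) (X := insert a Q) x
  rw [Finset.insert_comm, hS4] at h2
  have h3 := rkN_insert_le (M := M) (X := Q) x
  have h4 := rkN_insert_le (M := M) (X := insert x Q) a
  rw [hS4] at h4
  omega

/-- The outer set of `(Q ∖ y) ∪ a` is that of `Q ∪ a` (`Q` a full `3`-point line, `a ∉ Q`, simple). -/
theorem outer_insert_erase_eq (hsimple : ∀ X ⊆ gr M, X.card = 2 → rkN M X = 2)
    (h3line : ∀ X ⊆ gr M, rkN M X ≤ 2 → X.card ≤ 3) {Q : Finset α} {a : α} (hQg : Q ⊆ gr M) (hag : a ∈ gr M)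
    (hQ2 : rkN M Q = 2) (hQc : Q.card = 3) (haQ : a ∉ Q) {y : α} (hy : y ∈ Q) :
    outer M (insert a (Q.erase y)) = outer M (insert a Q) := by
  have hclQ : clF M Q = Q := clF_eq_self_of_line h3line hQg hQ2 hQc
  have hQy2 : rkN M (Q.erase y) = 2 := by
    apply hsimple _ ((Finset.erase_subset _ _).trans hQg)
    rw [Finset.card_erase_of_mem hy, hQc]
  have ha_outQ : a ∈ outer M Q := by rw [mem_outer, hclQ]; exact ⟨hag, haQ⟩
  have ha_outy : a ∈ outer M (Q.erase y) := by
    rw [outer_erase_eq_of_rkN_erase_eq (by rw [hQy2, hQ2])]; exact ha_outQ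
  have h1 : rkN M (insert a (Q.erase y)) = 3 := by rw [rkN_insert_of_mem_outer ha_outy, hQy2]
  have h2 : rkN M (insert a Q) = 3 := by rw [rkN_insert_of_mem_outer ha_outQ, hQ2]
  unfold outer
  rw [clF_eq_clF_of_subset_of_rkN_le (Finset.insert_subset_insert a (Finset.erase_subset y Q)) (by rw [h1, h2])]

/-- **Lemma 3 in the co-line case** `|F_a| = 2`: `rigid (Q ∪ {a, x}) ≤ 4`. -/
theorem rigid_le_four_of_outer_card_two (hsimple : ∀ X ⊆ gr M, X.card = 2 → rkN M X = 2)
    (h3line : ∀ X ⊆ gr M, rkN M X ≤ 2 → X.card ≤ 3) (hR : (5 : ℕ∞) ≤ M.eRank)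
    {Q : Finset α} {a x : α} (hQg : Q ⊆ gr M) (hag : a ∈ gr M) (hxg : x ∈ gr M) (hQ2 : rkN M Q = 2) (hQc : Q.card = 3)
    (haQ : a ∉ Q) (hxQ : x ∉ Q) (hax : a ≠ x) (hS4 : rkN M (insert a (insert x Q)) = 4)
    (hFa : (outer M (insert a Q)).card = 2) : rigid M (insert a (insert x Q)) ≤ 4 := by
  obtain ⟨haQ3, hxQ3⟩ := rkN_triples_eq_three hQ2 hS4
  have hFx2 : 2 ≤ (outer M (insert x Q)).card := two_le_card_outer hxQ3 hR
  have hFx2' : (2 : ℚ) ≤ ((outer M (insert x Q)).card : ℚ) := by exact_mod_cast hFx2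
  have hdcol2 : (dcol M (insert a (insert x Q))).card ≤ 2 := by
    have := Finset.card_le_card ((dcol_subset_coloops _).trans
      (coloops_subset_pair hsimple hQg hag hxg hQ2 hQc haQ hxQ hS4))
    rw [Finset.card_pair hax] at this; exact this
  -- the a-side terms are ≤ 1/2
  have hca : ∀ y ∈ Q, ovf M (insert a (Q.erase y)) x / ((inner M (insert a (Q.erase y))).card : ℚ) ≤ 1 / 2 := by
    intro y hy
    have hBg : insert a (Q.erase y) ⊆ gr M := Finset.insert_subset hag ((Finset.erase_subset _ _).trans hQg)
    have := ls_term_le_inv_card_outer (M := M) hBg x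
    rw [outer_insert_erase_eq hsimple h3line hQg hag hQ2 hQc haQ hy, hFa] at this
    simpa using this
  -- the x-side terms are ≤ 1/|F_x|
  have hcx : ∀ y ∈ Q, ovf M (insert x (Q.erase y)) a / ((inner M (insert x (Q.erase y))).card : ℚ) ≤
      1 / ((outer M (insert x Q)).card : ℚ) := by
    intro y hy
    have hBg : insert x (Q.erase y) ⊆ gr M := Finset.insert_subset hxg ((Finset.erase_subset _ _).trans hQg)
    have := ls_term_le_inv_card_outer (M := M) hBg a
    rw [outer_insert_erase_eq hsimple h3line hQg hxg hQ2 hQc hxQ hy] at this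
    exact this
  have hinvFx : 1 / ((outer M (insert x Q)).card : ℚ) ≤ 1 / 2 :=
    one_div_le_one_div_of_le (by norm_num) hFx2'
  by_cases hxd : 4 ≤ crk M (insert x Q)
  · -- the x-side excesses vanish
    have hcx0 : ∀ y ∈ Q, ovf M (insert x (Q.erase y)) a / ((inner M (insert x (Q.erase y))).card : ℚ) ≤ 0 :=
      fun y hy => ls_term_nonpos_of_jB_eq_zero a
        (jB_eq_zero_xside hsimple h3line hR hQg hag hxg hQ2 hQc hxQ hS4 hFa hxd hy rfl rfl)
    have h := rigid_two_coloops_le hsimple hQg hag hxg hQ2 hQc haQ hxQ hax hS4 (ca := 1 / 2) (cx := 0)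
      (by norm_num) le_rfl hca hcx0
    have hd : ((dcol M (insert a (insert x Q))).card : ℚ) ≤ 2 := by exact_mod_cast hdcol2
    linarith
  · -- a ∉ dcol S, so #dcol ≤ 1
    have hdcol1 : (dcol M (insert a (insert x Q))).card ≤ 1 := by
      have hsub : dcol M (insert a (insert x Q)) ⊆ {x} := by
        intro z hz
        have hz' := (dcol_subset_coloops _).trans
          (coloops_subset_pair hsimple hQg hag hxg hQ2 hQc haQ hxQ hS4) hz
        rw [Finset.mem_insert, Finset.mem_singleton] at hz'
        rw [Finset.mem_singleton]
        rcases hz' with rfl | rfl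
        · exfalso
          rw [mem_dcol] at hz
          have haxQ : z ∉ insert x Q := by rw [Finset.mem_insert]; push Not; exact ⟨hax, haQ⟩
          rw [Finset.erase_insert haxQ] at hz
          exact hxd hz.2.2
        · rfl
      have := Finset.card_le_card hsub
      rw [Finset.card_singleton] at this; exact this
    have h := rigid_two_coloops_le hsimple hQg hag hxg hQ2 hQc haQ hxQ hax hS4 (ca := 1 / 2)
      (cx := 1 / ((outer M (insert x Q)).card : ℚ)) (by norm_num) (by positivity) hca hcx
    have hd : ((dcol M (insert a (insert x Q))).card : ℚ) ≤ 1 := by exact_mod_cast hdcol1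
    linarith

/-- **LEMMA 3 of LINE3**: in a simple matroid of rank `≥ 5` with all lines `≤ 3` points, a two-coloop rank-`4` set
`Q ∪ {a, x}` (`Q` a full `3`-point line) has `rigid ≤ 4`. -/
theorem rigid_le_four_two_coloops_line3 (hsimple : ∀ X ⊆ gr M, X.card = 2 → rkN M X = 2)
    (h3line : ∀ X ⊆ gr M, rkN M X ≤ 2 → X.card ≤ 3) (hR : (5 : ℕ∞) ≤ M.eRank)
    {Q : Finset α} {a x : α} (hQg : Q ⊆ gr M) (hag : a ∈ gr M) (hxg : x ∈ gr M) (hQ2 : rkN M Q = 2) (hQc : Q.card = 3)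
    (haQ : a ∉ Q) (hxQ : x ∉ Q) (hax : a ≠ x) (hS4 : rkN M (insert a (insert x Q)) = 4) :
    rigid M (insert a (insert x Q)) ≤ 4 := by
  obtain ⟨haQ3, hxQ3⟩ := rkN_triples_eq_three hQ2 hS4
  by_cases hFa : (outer M (insert a Q)).card = 2
  · exact rigid_le_four_of_outer_card_two hsimple h3line hR hQg hag hxg hQ2 hQc haQ hxQ hax hS4 hFa
  by_cases hFx : (outer M (insert x Q)).card = 2
  · rw [Finset.insert_comm]
    exact rigid_le_four_of_outer_card_two hsimple h3line hR hQg hxg hag hQ2 hQc hxQ haQ hax.symm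
      (by rw [Finset.insert_comm]; exact hS4) hFx
  -- both planes have ≥ 3 outer points
  have hFa3 : (3 : ℚ) ≤ ((outer M (insert a Q)).card : ℚ) := by
    have := two_le_card_outer haQ3 hR
    have h3 : 3 ≤ (outer M (insert a Q)).card := by omega
    exact_mod_cast h3
  have hFx3 : (3 : ℚ) ≤ ((outer M (insert x Q)).card : ℚ) := by
    have := two_le_card_outer hxQ3 hR
    have h3 : 3 ≤ (outer M (insert x Q)).card := by omega
    exact_mod_cast h3
  have hdcol2 : ((dcol M (insert a (insert x Q))).card : ℚ) ≤ 2 := by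
    have := Finset.card_le_card ((dcol_subset_coloops _).trans
      (coloops_subset_pair hsimple hQg hag hxg hQ2 hQc haQ hxQ hS4))
    rw [Finset.card_pair hax] at this; exact_mod_cast this
  have hca : ∀ y ∈ Q, ovf M (insert a (Q.erase y)) x / ((inner M (insert a (Q.erase y))).card : ℚ) ≤
      1 / ((outer M (insert a Q)).card : ℚ) := by
    intro y hy
    have hBg : insert a (Q.erase y) ⊆ gr M := Finset.insert_subset hag ((Finset.erase_subset _ _).trans hQg)
    have := ls_term_le_inv_card_outer (M := M) hBg x
    rw [outer_insert_erase_eq hsimple h3line hQg hag hQ2 hQc haQ hy] at this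
    exact this
  have hcx : ∀ y ∈ Q, ovf M (insert x (Q.erase y)) a / ((inner M (insert x (Q.erase y))).card : ℚ) ≤
      1 / ((outer M (insert x Q)).card : ℚ) := by
    intro y hy
    have hBg : insert x (Q.erase y) ⊆ gr M := Finset.insert_subset hxg ((Finset.erase_subset _ _).trans hQg)
    have := ls_term_le_inv_card_outer (M := M) hBg a
    rw [outer_insert_erase_eq hsimple h3line hQg hxg hQ2 hQc hxQ hy] at this
    exact this
  have h := rigid_two_coloops_le hsimple hQg hag hxg hQ2 hQc haQ hxQ hax hS4
    (ca := 1 / ((outer M (insert a Q)).card : ℚ)) (cx := 1 / ((outer M (insert x Q)).card : ℚ))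
    (by positivity) (by positivity) hca hcx
  have ha3 : 1 / ((outer M (insert a Q)).card : ℚ) ≤ 1 / 3 := one_div_le_one_div_of_le (by norm_num) hFa3
  have hx3 : 1 / ((outer M (insert x Q)).card : ℚ) ≤ 1 / 3 := one_div_le_one_div_of_le (by norm_num) hFx3
  linarith

end Staged
end PercRepro

/-!
# SESSION 4 (continued) — LEMMA 8 AND THE FULL ONE-COLOOP CASE (night-3 g12; proofs/NIGHT3-G12-LINE3.md §3–§4)
Lemma 8 (the two small cases `|F_C| = 2`, `|cl C| ∈ {7, 8}`, `|C| ≥ 7`): then `|T_C| ≤ 1`, `C` is not demanding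
(`crk C ≤ f_C + |T_C| ≤ 3`), and the crude bound gives `rigid (C ∪ x) ≤ |C| / 2 ≤ 4` (`rigid_insert_le_four_small`).
With Line3E: **every** `C ∪ {x}` (`C ⊆ gr M` coloop-free of rank `3`, `x ∈ F_C`) has `rigid ≤ 4` in a matroid of rank `≥ 5`
with all lines `≤ 3` points (`rigid_insert_le_four_line3_full`).
-/
open scoped Matroid
namespace PercRepro
open Set Finset ThmH
namespace Staged
variable {α : Type} [DecidableEq α] {M : Matroid α} [M.Finite]

/-- If `C` is not demanding, `C ∪ {x}` has no demanding coloop-triple and `rigid (C ∪ x) ≤ |C| / |F_C|`. -/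
theorem rigid_insert_le_of_not_dem {C : Finset α} {x : α} (hCg : C ⊆ gr M) (hC3 : rkN M C = 3)
    (hfree : ∀ z ∈ C, rkN M (C.erase z) = 3) (hx : x ∈ outer M C) (hnd : ¬ 4 ≤ crk M C) :
    rigid M (insert x C) ≤ (C.card : ℚ) / ((outer M C).card : ℚ) := by
  have hxC : x ∉ C := notMem_of_mem_outer hCg hx
  have hSg : insert x C ⊆ gr M := Finset.insert_subset (mem_outer.mp hx).1 hCg
  have hk := coloops_insert_eq_singleton hCg hC3 hfree hx
  have hd : dcol M (insert x C) = ∅ := by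
    rw [Finset.eq_empty_iff_forall_notMem]
    intro z hz
    have hz' := (dcol_subset_coloops _) hz
    rw [hk, Finset.mem_singleton] at hz'
    subst hz'
    rw [mem_dcol, Finset.erase_insert hxC] at hz
    exact hnd hz.2.2
  have h0 := rigid_le_card_dcol_add_sum_inv_outer (M := M) hSg
  rw [hd, Finset.card_empty, Nat.cast_zero, zero_add] at h0
  have hsum : ∑ yx ∈ lsPairs M (insert x C), 1 / ((outer M (((insert x C).erase yx.1).erase yx.2)).card : ℚ)
      = ∑ _yx ∈ lsPairs M (insert x C), 1 / ((outer M C).card : ℚ) := by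
    apply Finset.sum_congr rfl
    intro yx hyx
    have h2 : yx.2 = x := by
      have := lsPairs_subset_of_coloops_eq_singleton hSg hk hyx
      rw [Finset.mem_product, Finset.mem_singleton] at this; exact this.2
    rw [outer_erase_erase_eq_of_mem_lsPairs hSg hyx, h2, Finset.erase_insert hxC]
  have hcard : ((lsPairs M (insert x C)).card : ℚ) ≤ (C.card : ℚ) := by
    have h1 : (lsPairs M (insert x C)).card ≤ (((insert x C).erase x) ×ˢ ({x} : Finset α)).card :=
      Finset.card_le_card (lsPairs_subset_of_coloops_eq_singleton hSg hk)
    rw [Finset.card_product, Finset.card_singleton, mul_one, Finset.erase_insert hxC] at h1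
    exact_mod_cast h1
  rw [hsum, Finset.sum_const, nsmul_eq_mul] at h0
  have hnn : (0 : ℚ) ≤ 1 / ((outer M C).card : ℚ) := by positivity
  calc rigid M (insert x C) ≤ ((lsPairs M (insert x C)).card : ℚ) * (1 / ((outer M C).card : ℚ)) := h0
    _ ≤ (C.card : ℚ) * (1 / ((outer M C).card : ℚ)) := mul_le_mul_of_nonneg_right hcard hnn
    _ = (C.card : ℚ) / ((outer M C).card : ℚ) := by ring

/-- **Lemma 8 of LINE3**: `|F_C| = 2`, `|T_C| ≤ 1` and `|C| ≤ 8` give `rigid (C ∪ x) ≤ 4`. -/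
theorem rigid_insert_le_four_small {C : Finset α} {x : α} (hCg : C ⊆ gr M) (hC3 : rkN M C = 3)
    (hfree : ∀ z ∈ C, rkN M (C.erase z) = 3) (hx : x ∈ outer M C) (hF : (outer M C).card = 2)
    (hT : (inner M C).card ≤ 1) (hc : C.card ≤ 8) : rigid M (insert x C) ≤ 4 := by
  have hnd : ¬ 4 ≤ crk M C := by
    have h1 := crk_le_fB_add_card_inner (M := M) hCg
    have h2 : fB M C ≤ 2 := by unfold fB; rw [← hF]; exact rkN_le_card _
    omega
  have h := rigid_insert_le_of_not_dem hCg hC3 hfree hx hnd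
  rw [hF] at h
  have hc' : (C.card : ℚ) ≤ 8 := by exact_mod_cast hc
  have : (C.card : ℚ) / ((2 : ℕ) : ℚ) ≤ 4 := by
    rw [Nat.cast_ofNat, div_le_iff₀ (by norm_num)]; linarith
  linarith

/-- **The one-coloop case of Theorem L3, complete**: rank `≥ 5`, all lines `≤ 3` points, `C ⊆ gr M` coloop-free of rank `3`,
`x ∈ F_C` ⟹ `rigid (C ∪ x) ≤ 4`. -/
theorem rigid_insert_le_four_line3_full (h3line : ∀ X ⊆ gr M, rkN M X ≤ 2 → X.card ≤ 3) (hR : (5 : ℕ∞) ≤ M.eRank)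
    {C : Finset α} {x : α} (hCg : C ⊆ gr M) (hC3 : rkN M C = 3) (hfree : ∀ z ∈ C, rkN M (C.erase z) = 3)
    (hx : x ∈ outer M C) : rigid M (insert x C) ≤ 4 := by
  by_cases hex : (outer M C).card = 2 ∧ ((clF M C).card = 7 ∨ (clF M C).card = 8)
  · obtain ⟨hF, hP⟩ := hex
    by_cases hc : C.card ≤ 3 * (outer M C).card
    · exact rigid_insert_le_four_of_card_le hCg hC3 hfree hx hc
    · have hin := card_inner_add_card (M := M) hCg
      apply rigid_insert_le_four_small hCg hC3 hfree hx hF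
      · rcases hP with h7 | h8 <;> omega
      · rcases hP with h7 | h8 <;> omega
  · exact rigid_insert_le_four_line3 h3line hR hCg hC3 hfree hx hex

end Staged
end PercRepro
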